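import Summits.MatrixMultiplication.MatrixMultiplication.Theorems.FarEdgeDescentFieldNode
import HarnessLib

/-!
# Route `FarEdgeDescent` — Kernel XXII-A «the light edge: the special side is a regularity ladder of the shadow»

decomp-mm ROOT cell (D-0178), lens 2 «structural dichotomy: special vs generic», gen 46; Theses-free
(imports `FarEdgeDescentFieldNode` — hence `…SpectralHorn`, `…SpectralShadow`, `Literature`,
`Summits.….Statement` — only; every field `K`; item texts INLINE).  Cut of record UNCHANGED:
`closes (h₁ : FiniteSaturation) (h₂ : AnchoredLogConvexity) : MatrixMultiplication`.

THE OBJECT (Kernel XXI): the spectral shadow `Σ_K = {(ε_φ, d_φ)}` of the universal spectral points `φ`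
over `K` — depth `ε_φ = 1 − θ₂(φ) ∈ [0,1]`, darkness `d_φ = θ₁+θ₂+θ₃ − 2 ∈ [0, ω_K − 2]` — and the excess
`e_K(x) = ω_K(1,x,1) − (x+1) = sup_φ [d_φ − (x−1)·ε_φ]` (`isLUB_line`; here `excess_le_of_forall_line`).

WHAT THIS FILE TYPES.  The SPECIAL leaf `FiniteSaturation` and its whole rate ladder are statements about
the REGULARITY OF THE SHADOW AT ITS LIGHT EDGE `ε → 0⁺` (the face `θ₂ = 1` carries light points only,
`light_of_coord_eq_one`):
* §A  unconditionally the edge is pinched LOGARITHMICALLY: `d_φ ≤ √ε_φ + 9 / log(1/ε_φ)` for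
  `0 < ε_φ < 1` (`darkness_le_logPinch`; the true-object form of `ω(1,k,1) − k → 1`, Coppersmith 1982 /
  Lotti–Romani 1983, from the every-field horn `darkness_le_horn_coord`);
* §B–§C  **the open split child `PowerAmortisation` (stmt-MatrixMultiplication-25347, text
  `∃ δ > 0, C, ∀ k ≥ 1, e(k) ≤ C·k^{−δ}`, read over `K`) is EQUIVALENT to a HÖLDER PINCH of the light edge**
  `∃ γ ∈ (0,1), C, ∀φ, d_φ ≤ C·ε_φ^γ` (`powerRateShape_iff_holderShadow`), with the EXACT exponent
  dictionary `γ = δ/(1+δ)`, `δ = γ/(1−γ)` (`holder_of_powerRate`: rate `δ` ⟹ Hölder exponent `δ/(1+δ)`,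
  constant `1 + C`, via the format `k = ⌈ε^{−1/(1+δ)}⌉`; `excess_le_of_holder` / `powerRate_of_holder`:
  Hölder exponent `γ` ⟹ `e(x) ≤ C·(C/(x−1))^{γ/(1−γ)}` for every real `x > 1`, a Legendre-type bound);
* the leaf itself is the LIPSCHITZ pinch `∃ M, d_φ ≤ M·ε_φ` (`finiteSaturationShape_iff_slopeBounded`, XXI-C)
  and the summit is `d ≡ 0` (`omega_eq_two_iff_noDark`, XXI-A); §D records the ladder
  `Lipschitz ⟹ Hölder ⟹ power rate` over every field (`holderShadow_of_slopeBounded`,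
  `powerRateShape_of_finiteSaturationShape` — the every-field, Theses-free form of the route's
  `powerAmortisation_of_finiteSaturation`).
So, on the true object, SPECIAL = «the upper boundary of the shadow is Lipschitz (resp. Hölder) at the
light corner (0,0)», while GENERIC (`AnchoredLogConvexity`) constrains the OTHER end of the shadow, its top
fibre `d = ω_K − 2` (top isolation, the exponential floor, near-top abundance: XXI-B/C/D).  The two leaves of
the cut localise at the two ends of one planar set.

NO definitions (gate rule D-0009).  Nothing here proves `ω = 2`.
References: [cite: Coppersmith1982, Thm. 1]; [cite: LottiRomani1983, Prop. 4.1, §2]; [cite: Strassen1988,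
Thm. 3.8]; [cite: AlmanLi2026, Proposition 4.1, Proposition 4.2].
-/

set_option linter.dupNamespace false

noncomputable section

open scoped BigOperators

namespace Summit.MatrixMultiplication.MatrixMultiplication.Theorems.FarEdgeDescentHolderShadow

open Literature.Computability.AlgebraicComplexity
open Summit.MatrixMultiplication.MatrixMultiplication.Theorems.FarEdgeDescentSpectralShadow
open Summit.MatrixMultiplication.MatrixMultiplication.Theorems.FarEdgeDescentSpectralHorn
open Summit.MatrixMultiplication.MatrixMultiplication.Theorems.FarEdgeDescentFieldNode

variable {K : Type} [Field K]

/-! ## §0 The excess is the supremum of the line gaps -/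

/-- **A uniform bound on the line gaps bounds the excess**: if every universal spectral point has
`d_φ − (x−1)·ε_φ ≤ B` (`x ≥ 0` real), then `e(x) = ω_K(1,x,1) − (x+1) ≤ B` — the pencil is the least upper
bound of the spectral lines (`isLUB_line`). [cite: Strassen1988, Thm. 3.8] [cite: AlmanLi2026, Proposition 4.1] -/
theorem excess_le_of_forall_line {x B : ℝ} (hx : 0 ≤ x)
    (h : ∀ F : SpectralMap K, IsUniversalSpectralPoint K F →
      (∑ i, specMMPoint K F i) - 2 - (x - 1) * (1 - specMMPoint K F 1) ≤ B) :
    omegaRect K 1 x 1 - (x + 1) ≤ B := by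
  have hub : x + 1 + B ∈ upperBounds
      ((fun F : SpectralMap K => specMMPoint K F 0 + x * specMMPoint K F 1 + specMMPoint K F 2) ''
        {F | IsUniversalSpectralPoint K F}) := by
    rintro _ ⟨F, hF, rfl⟩
    have hB := h F hF
    rw [sum_three] at hB
    have e : specMMPoint K F 0 + specMMPoint K F 1 + specMMPoint K F 2 - 2 -
        (x - 1) * (1 - specMMPoint K F 1) =
        specMMPoint K F 0 + x * specMMPoint K F 1 + specMMPoint K F 2 - (x + 1) := by ring
    rw [e] at hB
    show specMMPoint K F 0 + x * specMMPoint K F 1 + specMMPoint K F 2 ≤ x + 1 + B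
    linarith
  have := (isLUB_line (K := K) hx).2 hub
  linarith

/-! ## §A The unconditional logarithmic pinch of the light edge -/

/-- **The light edge of the shadow is pinched logarithmically** (unconditional, every field): a universal
spectral point of depth `ε = 1 − θ₂ ∈ (0,1)` has darkness `θ₁+θ₂+θ₃ − 2 ≤ √ε + 9 / log(1/ε)` (the horn
`d ≤ (k−1)ε + 9/(2 log(k+2))` at the format `k + 2 = ⌈ε^{−1/2}⌉`).  The true-object form of
`ω(1,k,1) − k → 1`. [cite: Coppersmith1982, Thm. 1] [cite: LottiRomani1983, Prop. 4.1] -/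
theorem darkness_le_logPinch {F : SpectralMap K} (hF : IsUniversalSpectralPoint K F)
    (h0 : 0 < 1 - specMMPoint K F 1) (h1 : 1 - specMMPoint K F 1 < 1) :
    (∑ i, specMMPoint K F i) - 2 ≤
      Real.sqrt (1 - specMMPoint K F 1) + 9 / Real.log (1 / (1 - specMMPoint K F 1)) := by
  set ε : ℝ := 1 - specMMPoint K F 1 with hε
  have hs0 : 0 < Real.sqrt ε := Real.sqrt_pos.2 h0
  have hs1 : Real.sqrt ε < 1 := by
    rw [show (1 : ℝ) = Real.sqrt 1 from Real.sqrt_one.symm]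
    exact Real.sqrt_lt_sqrt h0.le h1
  -- the format: `N = ⌈1/√ε⌉ ≥ 2`, `k = N − 2`
  set y : ℝ := 1 / Real.sqrt ε with hy
  have hy1 : 1 < y := by rw [hy, lt_div_iff₀ hs0, one_mul]; exact hs1
  have hy0 : 0 ≤ y := by linarith
  obtain ⟨k, hk⟩ : ∃ k : ℕ, ⌈y⌉₊ = k + 2 := by
    have h2 : 2 ≤ ⌈y⌉₊ := Nat.lt_ceil.2 (by exact_mod_cast hy1)
    exact ⟨⌈y⌉₊ - 2, by omega⟩
  have hNy : y ≤ (⌈y⌉₊ : ℝ) := Nat.le_ceil y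
  have hNy' : (⌈y⌉₊ : ℝ) < y + 1 := Nat.ceil_lt_add_one hy0
  rw [hk] at hNy hNy'
  push_cast at hNy hNy'
  -- the horn at `k`
  have hhorn := darkness_le_horn_coord hF 1 k
  rw [← hε] at hhorn
  -- linear term: `(k−1)ε ≤ y ε = √ε`
  have hlin : ((k : ℝ) - 1) * ε ≤ Real.sqrt ε := by
    have h3 : ((k : ℝ) - 1) * ε ≤ y * ε := mul_le_mul_of_nonneg_right (by linarith) h0.le
    have h4 : y * ε = Real.sqrt ε := by
      rw [hy, one_div, inv_mul_eq_div, Real.div_sqrt]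
    linarith
  -- logarithmic term: `log(k+2) ≥ log y = (1/2) log(1/ε)`
  have hL : 0 < Real.log (1 / ε) := Real.log_pos (by rw [lt_div_iff₀ h0]; linarith)
  have hlogy : Real.log y = Real.log (1 / ε) / 2 := by
    rw [hy, Real.log_div one_ne_zero hs0.ne', Real.log_one, Real.log_sqrt h0.le,
      Real.log_div one_ne_zero h0.ne', Real.log_one]
    ring
  have hlog : Real.log (1 / ε) ≤ 2 * Real.log ((k : ℝ) + 2) := by
    have := Real.log_le_log (by linarith) hNy
    rw [hlogy] at this
    linarith
  have htail : 9 / (2 * Real.log ((k : ℝ) + 2)) ≤ 9 / Real.log (1 / ε) :=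
    div_le_div_of_nonneg_left (by norm_num) hL hlog
  linarith

/-! ## §B Power amortisation ⟹ Hölder pinch (exponent `δ ↦ δ/(1+δ)`) -/

/-- **A power rate of the special side pinches the light edge Hölder-wise**: if `e(k) ≤ C·k^{−δ}` for every
natural `k ≥ 1` (`δ > 0`), then every universal spectral point obeys `d_φ ≤ (1 + C)·ε_φ^{δ/(1+δ)}`
(choose the format `k = ⌈ε^{−1/(1+δ)}⌉`: `d ≤ (k−1)ε + e(k)`, both terms `≤ ε^{δ/(1+δ)}` up to `C`).
[cite: Strassen1988, Thm. 3.8] [cite: LottiRomani1983, §2 (p. 174)] -/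
theorem holder_of_powerRate {δ C : ℝ} (hδ : 0 < δ)
    (hPA : ∀ k : ℕ, 1 ≤ k → omegaRect K 1 k 1 - (k + 1) ≤ C * (k : ℝ) ^ (-δ))
    {F : SpectralMap K} (hF : IsUniversalSpectralPoint K F) :
    (∑ i, specMMPoint K F i) - 2 ≤ (1 + C) * (1 - specMMPoint K F 1) ^ (δ / (1 + δ)) := by
  have hθ := AlmanLi2026.prop42_mem_Icc hF 1
  set ε : ℝ := 1 - specMMPoint K F 1 with hε
  have hε0 : 0 ≤ ε := by rw [hε]; linarith [hθ.2]
  have hε1 : ε ≤ 1 := by rw [hε]; linarith [hθ.1]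
  -- `C ≥ 0` (the excess at `k = 1` is `ω_K − 2 ≥ 0`)
  have hC : 0 ≤ C := by
    have h1 := hPA 1 le_rfl
    rw [Nat.cast_one, Real.one_rpow, mul_one] at h1
    have h2 := two_le_omegaRect_one_mid_one K (1 : ℝ)
    linarith
  set γ : ℝ := δ / (1 + δ) with hγ
  have h1δ : (1 + δ) ≠ 0 := by positivity
  have hγ0 : 0 < γ := by positivity
  rcases hε0.lt_or_eq with hpos | hzero
  · -- `ε > 0`: the format `k = ⌈y⌉`, `y = ε^{−1/(1+δ)} ≥ 1`
    set y : ℝ := ε ^ (-(1 / (1 + δ))) with hy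
    have hy1 : 1 ≤ y := by
      have := Real.rpow_le_rpow_of_nonpos hpos hε1 (show -(1 / (1 + δ)) ≤ 0 by
        rw [neg_nonpos]; positivity)
      rwa [Real.one_rpow] at this
    have hy0 : 0 < y := by linarith
    set k : ℕ := ⌈y⌉₊ with hk
    have hky : y ≤ (k : ℝ) := Nat.le_ceil y
    have hky' : (k : ℝ) < y + 1 := Nat.ceil_lt_add_one hy0.le
    have hk1 : 1 ≤ k := by
      have : (0 : ℝ) < k := lt_of_lt_of_le hy0 hky
      exact_mod_cast this
    -- `d ≤ (k−1)ε + e(k)`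
    have hd := darkness_le_far hF (Nat.cast_nonneg k)
    rw [← hε] at hd
    -- the two exponent identities
    have eγ1 : γ = -(1 / (1 + δ)) * -δ := by rw [hγ]; field_simp
    have eγ2 : γ = -(1 / (1 + δ)) + 1 := by rw [hγ]; field_simp; ring
    -- `e(k) ≤ C k^{−δ} ≤ C y^{−δ} = C ε^γ`
    have hkδ : (k : ℝ) ^ (-δ) ≤ y ^ (-δ) := Real.rpow_le_rpow_of_nonpos hy0 hky (by linarith)
    have hyδ : y ^ (-δ) = ε ^ γ := by rw [hy, ← Real.rpow_mul hε0, ← eγ1]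
    have h2 : omegaRect K 1 k 1 - (k + 1) ≤ C * ε ^ γ := by
      refine (hPA k hk1).trans ?_
      rw [← hyδ]
      exact mul_le_mul_of_nonneg_left hkδ hC
    -- `(k−1)ε ≤ y ε = ε^γ`
    have hyε : y * ε = ε ^ γ := by rw [hy, eγ2, Real.rpow_add hpos, Real.rpow_one]
    have h1 : ((k : ℝ) - 1) * ε ≤ ε ^ γ := by
      rw [← hyε]
      exact mul_le_mul_of_nonneg_right (by linarith) hε0
    calc (∑ i, specMMPoint K F i) - 2 ≤ ((k : ℝ) - 1) * ε + (omegaRect K 1 k 1 - (k + 1)) := hd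
      _ ≤ ε ^ γ + C * ε ^ γ := add_le_add h1 h2
      _ = (1 + C) * ε ^ γ := by ring
  · -- `ε = 0`: the point lies on the face `θ₂ = 1`, hence is light
    have hθ1 : specMMPoint K F 1 = 1 := by rw [hε] at hzero; linarith
    rw [light_of_coord_eq_one hF 1 hθ1, ← hzero, Real.zero_rpow hγ0.ne', mul_zero]
    norm_num

/-! ## §C Hölder pinch ⟹ power amortisation (exponent `γ ↦ γ/(1−γ)`) -/

/-- The scalar Legendre-type bound: if `d ≤ C·t^γ` (`0 < γ < 1`, `C ≥ 0`, `t ≥ 0`) then for every slope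
`s > 0`, `d − s·t ≤ C·(C/s)^{γ/(1−γ)}` (either `s t ≥ C t^γ`, or `t^{1−γ} < C/s`). [folklore] -/
theorem lineGap_le_of_holder {γ C t s d : ℝ} (hγ0 : 0 < γ) (hγ1 : γ < 1) (hC : 0 ≤ C)
    (ht : 0 ≤ t) (hs : 0 < s) (hd : d ≤ C * t ^ γ) :
    d - s * t ≤ C * (C / s) ^ (γ / (1 - γ)) := by
  have h1γ : 0 < 1 - γ := by linarith
  have hB : 0 ≤ C * (C / s) ^ (γ / (1 - γ)) :=
    mul_nonneg hC (Real.rpow_nonneg (div_nonneg hC hs.le) _)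
  by_cases hcase : C * t ^ γ ≤ s * t
  · linarith
  · rw [not_le] at hcase
    -- `t > 0`
    have htpos : 0 < t := by
      rcases ht.lt_or_eq with h | h
      · exact h
      · rw [← h, Real.zero_rpow hγ0.ne', mul_zero, mul_zero] at hcase
        exact absurd hcase (lt_irrefl 0)
    -- `s t^{1−γ} < C`
    have hsplit : t = t ^ (1 - γ) * t ^ γ := by
      rw [← Real.rpow_add htpos, sub_add_cancel, Real.rpow_one]
    have htγ : 0 < t ^ γ := Real.rpow_pos_of_pos htpos γ
    have h2 : s * t ^ (1 - γ) < C := by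
      have h' : s * t ^ (1 - γ) * t ^ γ < C * t ^ γ := by
        rw [mul_assoc, ← hsplit]
        exact hcase
      exact lt_of_mul_lt_mul_right h' htγ.le
    -- `t^{1−γ} < C/s`, raise to the power `γ/(1−γ) > 0`
    have h3 : t ^ (1 - γ) < C / s := by
      rw [lt_div_iff₀ hs, mul_comm]
      exact h2
    have h4 : (t ^ (1 - γ)) ^ (γ / (1 - γ)) < (C / s) ^ (γ / (1 - γ)) :=
      Real.rpow_lt_rpow (Real.rpow_nonneg ht _) h3 (by positivity)
    have e : (t ^ (1 - γ)) ^ (γ / (1 - γ)) = t ^ γ := by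
      rw [← Real.rpow_mul ht]
      congr 1
      field_simp
    rw [e] at h4
    have h5 : C * t ^ γ ≤ C * (C / s) ^ (γ / (1 - γ)) := mul_le_mul_of_nonneg_left h4.le hC
    have h6 : 0 ≤ s * t := mul_nonneg hs.le ht
    linarith

/-- **A Hölder pinch of the light edge bounds the excess at every real format `x > 1`**:
`(∀φ, d_φ ≤ C·ε_φ^γ)` (`0 < γ < 1`, `C ≥ 0`) gives `e(x) ≤ C·(C/(x−1))^{γ/(1−γ)}`.
[cite: Strassen1988, Thm. 3.8] [cite: AlmanLi2026, Proposition 4.1] -/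
theorem excess_le_of_holder {γ C : ℝ} (hγ0 : 0 < γ) (hγ1 : γ < 1) (hC : 0 ≤ C)
    (hHS : ∀ F : SpectralMap K, IsUniversalSpectralPoint K F →
      (∑ i, specMMPoint K F i) - 2 ≤ C * (1 - specMMPoint K F 1) ^ γ)
    {x : ℝ} (hx : 1 < x) :
    omegaRect K 1 x 1 - (x + 1) ≤ C * (C / (x - 1)) ^ (γ / (1 - γ)) :=
  excess_le_of_forall_line (by linarith) fun F hF =>
    lineGap_le_of_holder hγ0 hγ1 hC (by linarith [(AlmanLi2026.prop42_mem_Icc hF 1).2])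
      (by linarith) (hHS F hF)

/-- Under a Hölder pinch with constant `C ≥ 0`, `e(x) ≤ C` for every real `x ≥ 1` (in particular
`ω_K − 2 ≤ C`): `d − (x−1)ε ≤ d ≤ C ε^γ ≤ C`. [cite: Strassen1988, Thm. 3.8] -/
theorem excess_le_const_of_holder {γ C : ℝ} (hγ0 : 0 < γ) (hC : 0 ≤ C)
    (hHS : ∀ F : SpectralMap K, IsUniversalSpectralPoint K F →
      (∑ i, specMMPoint K F i) - 2 ≤ C * (1 - specMMPoint K F 1) ^ γ)
    {x : ℝ} (hx : 1 ≤ x) : omegaRect K 1 x 1 - (x + 1) ≤ C := by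
  refine excess_le_of_forall_line (by linarith) fun F hF => ?_
  have hθ := AlmanLi2026.prop42_mem_Icc hF 1
  have hεγ : (1 - specMMPoint K F 1) ^ γ ≤ 1 :=
    Real.rpow_le_one (by linarith [hθ.2]) (by linarith [hθ.1]) hγ0.le
  have h1 := hHS F hF
  have h2 : C * (1 - specMMPoint K F 1) ^ γ ≤ C := by nlinarith
  have h3 : 0 ≤ (x - 1) * (1 - specMMPoint K F 1) := mul_nonneg (by linarith) (by linarith [hθ.2])
  linarith

/-- **Hölder pinch ⟹ power amortisation**: `(∀φ, d_φ ≤ C·ε_φ^γ)` (`0 < γ < 1`, `C ≥ 0`) gives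
`e(k) ≤ (C + C·(2C)^{δ})·k^{−δ}` for every natural `k ≥ 1`, with `δ = γ/(1−γ)` (for `k ≥ 2`,
`C/(k−1) ≤ 2C/k`; for `k = 1`, `e(1) ≤ C`). [cite: Strassen1988, Thm. 3.8] [cite: LottiRomani1983, §2 (p. 174)] -/
theorem powerRate_of_holder {γ C : ℝ} (hγ0 : 0 < γ) (hγ1 : γ < 1) (hC : 0 ≤ C)
    (hHS : ∀ F : SpectralMap K, IsUniversalSpectralPoint K F →
      (∑ i, specMMPoint K F i) - 2 ≤ C * (1 - specMMPoint K F 1) ^ γ)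
    (k : ℕ) (hk : 1 ≤ k) :
    omegaRect K 1 k 1 - (k + 1) ≤ (C + C * (2 * C) ^ (γ / (1 - γ))) * (k : ℝ) ^ (-(γ / (1 - γ))) := by
  have h1γ : 0 < 1 - γ := by linarith
  set δ : ℝ := γ / (1 - γ) with hδ
  have hδ0 : 0 < δ := by positivity
  have hk0 : (0 : ℝ) < k := by exact_mod_cast hk
  have hkδ0 : 0 < (k : ℝ) ^ (-δ) := Real.rpow_pos_of_pos hk0 _
  have hA0 : 0 ≤ C * (2 * C) ^ δ := mul_nonneg hC (Real.rpow_nonneg (by linarith) _)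
  rcases (show 1 = k ∨ 2 ≤ k by omega) with h1 | h2
  · -- `k = 1`
    subst h1
    have he := excess_le_const_of_holder hγ0 hC hHS (le_refl (1 : ℝ))
    rw [Nat.cast_one, Real.one_rpow, mul_one]
    norm_num at he ⊢
    linarith
  · -- `k ≥ 2`
    have hk1 : (0 : ℝ) < (k : ℝ) - 1 := by
      have : (2 : ℝ) ≤ k := by exact_mod_cast h2
      linarith
    have he := excess_le_of_holder hγ0 hγ1 hC hHS (show (1 : ℝ) < k by linarith)
    rw [← hδ] at he
    -- `(C/(k−1))^δ ≤ (2C/k)^δ = (2C)^δ · k^{−δ}`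
    have hcmp : C / ((k : ℝ) - 1) ≤ 2 * C / k := by
      rw [div_le_div_iff₀ hk1 hk0]
      have : (k : ℝ) ≤ 2 * ((k : ℝ) - 1) := by
        have : (2 : ℝ) ≤ k := by exact_mod_cast h2
        linarith
      nlinarith
    have hpow : (C / ((k : ℝ) - 1)) ^ δ ≤ (2 * C) ^ δ * (k : ℝ) ^ (-δ) := by
      refine (Real.rpow_le_rpow (div_nonneg hC hk1.le) hcmp hδ0.le).trans (le_of_eq ?_)
      rw [Real.div_rpow (by linarith) hk0.le, Real.rpow_neg hk0.le, div_eq_mul_inv]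
    have h3 : C * (C / ((k : ℝ) - 1)) ^ δ ≤ C * (2 * C) ^ δ * (k : ℝ) ^ (-δ) := by
      rw [mul_assoc]
      exact mul_le_mul_of_nonneg_left hpow hC
    have h4 : 0 ≤ C * (k : ℝ) ^ (-δ) := mul_nonneg hC hkδ0.le
    calc omegaRect K 1 k 1 - (k + 1) ≤ C * (C / ((k : ℝ) - 1)) ^ δ := he
      _ ≤ C * (2 * C) ^ δ * (k : ℝ) ^ (-δ) := h3
      _ ≤ (C + C * (2 * C) ^ δ) * (k : ℝ) ^ (-δ) := by nlinarith

/-! ## §D The equivalence and the ladder -/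

/-- **`PowerAmortisation`'s text ⟺ a Hölder pinch of the light edge** (every field; at `K = ℂ` the left side
is literally the route item stmt-MatrixMultiplication-25347): `(∃ δ > 0, C, ∀ k ≥ 1, e(k) ≤ C k^{−δ}) ⟺
(∃ γ ∈ (0,1), C, ∀φ, d_φ ≤ C ε_φ^γ)`, exponents related by `γ = δ/(1+δ)`, `δ = γ/(1−γ)`.
[cite: Strassen1988, Thm. 3.8] [cite: LottiRomani1983, §2 (p. 174)] [cite: AlmanLi2026, Proposition 4.2] -/
theorem powerRateShape_iff_holderShadow :
    (∃ δ C : ℝ, 0 < δ ∧ ∀ k : ℕ, 1 ≤ k → omegaRect K 1 k 1 - (k + 1) ≤ C * (k : ℝ) ^ (-δ)) ↔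
      ∃ γ C : ℝ, 0 < γ ∧ γ < 1 ∧ ∀ F : SpectralMap K, IsUniversalSpectralPoint K F →
        (∑ i, specMMPoint K F i) - 2 ≤ C * (1 - specMMPoint K F 1) ^ γ := by
  constructor
  · rintro ⟨δ, C, hδ, hPA⟩
    refine ⟨δ / (1 + δ), 1 + C, by positivity, ?_, fun F hF => holder_of_powerRate hδ hPA hF⟩
    rw [div_lt_one (by positivity)]
    linarith
  · rintro ⟨γ, C, hγ0, hγ1, hHS⟩
    -- replace `C` by `max C 0 ≥ 0`
    have hHS' : ∀ F : SpectralMap K, IsUniversalSpectralPoint K F →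
        (∑ i, specMMPoint K F i) - 2 ≤ max C 0 * (1 - specMMPoint K F 1) ^ γ := fun F hF =>
      (hHS F hF).trans (mul_le_mul_of_nonneg_right (le_max_left _ _)
        (Real.rpow_nonneg (by linarith [(AlmanLi2026.prop42_mem_Icc hF 1).2]) _))
    have h1γ : 0 < 1 - γ := by linarith
    exact ⟨γ / (1 - γ), max C 0 + max C 0 * (2 * max C 0) ^ (γ / (1 - γ)), by positivity,
      fun k hk => powerRate_of_holder hγ0 hγ1 (le_max_right _ _) hHS' k hk⟩

/-- **Lipschitz ⟹ Hölder**: a cone `d_φ ≤ M·ε_φ` (`M ≥ 0`) gives `d_φ ≤ M·ε_φ^γ` for every `γ ∈ (0,1]`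
(`ε_φ ≤ 1`). [cite: AlmanLi2026, Proposition 4.2] -/
theorem holderShadow_of_slopeBounded {M : ℝ} (hM : 0 ≤ M)
    (h : ∀ F : SpectralMap K, IsUniversalSpectralPoint K F →
      (∑ i, specMMPoint K F i) - 2 ≤ M * (1 - specMMPoint K F 1))
    {γ : ℝ} (hγ0 : 0 < γ) (hγ1 : γ ≤ 1) {F : SpectralMap K} (hF : IsUniversalSpectralPoint K F) :
    (∑ i, specMMPoint K F i) - 2 ≤ M * (1 - specMMPoint K F 1) ^ γ := by
  have hθ := AlmanLi2026.prop42_mem_Icc hF 1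
  refine (h F hF).trans (mul_le_mul_of_nonneg_left ?_ hM)
  have := Real.rpow_le_rpow_of_exponent_ge' (x := 1 - specMMPoint K F 1)
    (by linarith [hθ.2]) (by linarith [hθ.1]) hγ0.le hγ1
  rwa [Real.rpow_one] at this

/-- **The special leaf implies its open child over EVERY field** (`FS_K ⟹` the `PowerAmortisation` shape
over `K`), through the shadow: cone (`finiteSaturationShape_iff_cone`) ⟹ Hölder pinch with `γ = 1/2`
⟹ power rate `δ = 1` (`powerRateShape_iff_holderShadow`).  The Theses-free, field-uniform form of the
route's `powerAmortisation_of_finiteSaturation`. [cite: LottiRomani1983, §2 (p. 174)] [cite: Strassen1988, Thm. 3.8] -/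
theorem powerRateShape_of_finiteSaturationShape (hFS : ∃ k : ℕ, 2 ≤ k ∧ omegaRect K 1 k 1 = k + 1) :
    ∃ δ C : ℝ, 0 < δ ∧ ∀ k : ℕ, 1 ≤ k → omegaRect K 1 k 1 - (k + 1) ≤ C * (k : ℝ) ^ (-δ) := by
  obtain ⟨k, hk2, hcone⟩ := finiteSaturationShape_iff_cone.1 hFS
  have hM : (0 : ℝ) ≤ (k : ℝ) - 1 := by
    have : (2 : ℝ) ≤ k := by exact_mod_cast hk2
    linarith
  exact powerRateShape_iff_holderShadow.2 ⟨1 / 2, (k : ℝ) - 1, by norm_num, by norm_num,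
    fun F hF => holderShadow_of_slopeBounded hM hcone (by norm_num) (by norm_num) hF⟩

end Summit.MatrixMultiplication.MatrixMultiplication.Theorems.FarEdgeDescentHolderShadow

end
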